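import Literature.Probability.Percolation.LinkQuad
import HarnessLib

/-!
# Ports of the tile domain: contact sides, hub contacts and touchability

Topic `Probability/Percolation`.  Tenth step of the cell-complex toolkit for the gluing theorem
(Schramm–Smirnov 2011, proof of Thm 1.5, step (C)).  The boundary of the tile domain `𝒯.U` is
traced by the loop of `CellBoundary`/`CellSides`; its `i`-th side separates the in-cell
`faceAt (vert i) (dirAt i)` from the **out-cell** `outCell i = faceAt (vert i) (dirAt i + 3)`.  The
contact point `cpt x k` of a dart (`LinkSemantics`) is the midpoint of the side between `σ x` and
`β x k`; here we identify the loop side carrying it and classify the contacts that an open edge can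
actually touch.

* `contactDart`, `faceAt_contactDart`, `cpt_eq_emid` — the side between `σ x` and `β x k` as a grid
  dart with `σ x` on its left, and the contact point as its midpoint;
* `outCell_eq_of_cpt_mem_edgeSeg` — if the contact point lies on the `i`-th loop side then the
  out-cell of that side is `β x k` (when `σ x ∈ U`) or `σ x` (when `β x k ∈ U`);
* `TileData.touchable` — **touchability**: for tile data consistent with `ω` (examined closed
  edges closed), an open contact dart with the boundary dichotomy is a **hub docking** (`σ x ∉ U`,
  `x ∈ 𝒪`, `β x k ∈ U`) or a **section contact** (`σ x ∈ U` and the edge leaves the window);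
* `IsHubCell`, `hubContact`; `cpt_not_mem_singleton_vertex`, `cpt_mem_arc_iff` — membership of a
  contact point in an arc of the marked cell complex is membership of its loop index in the index
  range of the arc.

Everything is proved; no named fact is introduced.

## References

* O. Schramm, S. Smirnov, Ann. Probab. 39 (2011), arXiv:1101.5820, proof of Thm 1.5 (C). [SchrammSmirnov2011]
-/

noncomputable section

open Set Metric Relation
open Literature.Probability.LatticeModels
open Literature.Probability.RandomPlanarGeometry

namespace Literature.Probability.Percolation

namespace CellComplex

/-! ### The contact side as a grid dart -/

/-- The grid dart of the side between `σ x` (left) and `β x k` (right). [folklore] -/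
def contactDart (x : Site 2) (k : Fin 4) : Site 2 × Fin 4 := (σc x + cornerOff (k + 1), k + 1)

/-- The cells of the contact dart: `σ x` on the left, `β x k` on the right. [folklore] -/
theorem faceAt_contactDart (x : Site 2) (k : Fin 4) :
    faceAt (contactDart x k).1 (contactDart x k).2 = σc x ∧ faceAt (contactDart x k).1 ((contactDart x k).2 + 3) = βc x k := by
  refine ⟨?_, ?_⟩
  · show faceAt (σc x + cornerOff (k + 1)) (k + 1) = σc x
    rw [faceAt]; abel
  · show faceAt (σc x + cornerOff (k + 1)) (k + 1 + 3) = βc x k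
    rw [fin4_add_one_add_three, faceAt, βc_eq, cornerUnit_eq_off_sub]; abel

/-- The cells of the reversed contact dart: `β x k` on the left, `σ x` on the right. [folklore] -/
theorem faceAt_contactDart_rev (x : Site 2) (k : Fin 4) :
    faceAt ((contactDart x k).1 + cornerUnit (contactDart x k).2) ((contactDart x k).2 + 2) = βc x k ∧
      faceAt ((contactDart x k).1 + cornerUnit (contactDart x k).2) ((contactDart x k).2 + 2 + 3) = σc x := by
  rw [faceAt_add_unit_add_two, fin4_add_two_add_three, faceAt_add_unit_succ]
  exact ⟨(faceAt_contactDart x k).2, (faceAt_contactDart x k).1⟩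

/-- **The contact point is the midpoint of the contact side.** [folklore] -/
theorem cpt_eq_emid (x : Site 2) (k : Fin 4) : cpt x k = emid (contactDart x k).1 (contactDart x k).2 := by
  show seg2Pt (σc x) k (1 / 4) = emid (σc x + cornerOff (k + 1)) (k + 1)
  apply Complex.ext
  · rw [(seg2Pt_σc_re_im x k (1 / 4)).1, emid]
    simp only [Complex.add_re, Complex.mul_re, Site.toComplex_re, σc_apply, toComplex_add]
    fin_cases k <;> simp [toComplex_cornerUnit_table, cornerOff] <;> norm_num <;> ring
  · rw [(seg2Pt_σc_re_im x k (1 / 4)).2, emid]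
    simp only [Complex.add_im, Complex.mul_im, Site.toComplex_im, σc_apply, toComplex_add]
    fin_cases k <;> simp [toComplex_cornerUnit_table, cornerOff] <;> norm_num <;> ring

/-- The midpoint of a grid edge lies on the segment between the centres of its two cells. [folklore] -/
theorem emid_mem_ctrSeg (v : Site 2) (m : Fin 4) : emid v m ∈ ctrSeg v m :=
  openSegment_subset_segment ℝ _ _ (emid_mem_openSegment_ctr v m)

/-- **The loop side carrying a contact point.**  If `cpt x k` lies on the edge segment of a boundary
dart `d` of `U` then `d` is the contact dart (when `σ x ∈ U`) or its reverse (when `β x k ∈ U`);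
in particular the out-cell of `d` is `β x k`, resp. `σ x`. [folklore] -/
theorem outCell_eq_of_cpt_mem_edgeSeg {U : Finset (Site 2)} {x : Site 2} {k : Fin 4} {d : Site 2 × Fin 4}
    (hd : IsBd U d) (hmem : cpt x k ∈ edgeSeg d.1 d.2) :
    (σc x ∈ U → d = contactDart x k ∧ faceAt d.1 (d.2 + 3) = βc x k) ∧
      (βc x k ∈ U → d = ((contactDart x k).1 + cornerUnit (contactDart x k).2, (contactDart x k).2 + 2) ∧
        faceAt d.1 (d.2 + 3) = σc x) := by
  rw [cpt_eq_emid] at hmem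
  obtain ⟨hL, hR⟩ := faceAt_contactDart x k
  obtain ⟨hL', hR'⟩ := faceAt_contactDart_rev x k
  obtain ⟨v, m⟩ := d
  rcases edge_eq_of_mem_ctrSeg (emid_mem_ctrSeg _ _) hmem with ⟨rfl, rfl⟩ | ⟨rfl, rfl⟩
  · -- `d` is the contact dart: its right cell `β x k` is out, so `σ x ∈ U` is the live case
    refine ⟨fun _ => ⟨rfl, hR⟩, fun hB => ?_⟩
    exact absurd (hR ▸ hB : faceAt (contactDart x k).1 ((contactDart x k).2 + 3) ∈ U) hd.2
  · refine ⟨fun hS => ?_, fun _ => ⟨rfl, hR'⟩⟩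
    have : faceAt ((contactDart x k).1 + cornerUnit (contactDart x k).2) ((contactDart x k).2 + 2 + 3) ∈ U := hR'.symm ▸ hS
    exact absurd this hd.2

/-! ### Touchability -/

namespace TileData

variable (𝒯 : TileData)

/-- **Touchability.**  For tile data consistent with `ω` (examined closed edges are closed in
`ω`), an open contact dart with the boundary dichotomy is either a hub docking — `σ x ∉ U`,
`x ∈ 𝒪` and `β x k ∈ U` — or a section contact — `σ x ∈ U` and the edge leaves the window.
[cite: SchrammSmirnov2011, proof of Thm 1.5 (C)] -/
theorem touchable {ω : BondConfig (Site 2)} (hcons : ∀ e ∈ 𝒯.clE, e ∉ ω) {x : Site 2} {k : Fin 4}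
    (hopen : dartEdge x k ∈ ω) (hside : (σc x ∈ 𝒯.U ∧ βc x k ∉ 𝒯.U) ∨ (σc x ∉ 𝒯.U ∧ βc x k ∈ 𝒯.U)) :
    (σc x ∉ 𝒯.U ∧ x ∈ 𝒯.O ∧ βc x k ∈ 𝒯.U) ∨ (σc x ∈ 𝒯.U ∧ βc x k ∉ 𝒯.U ∧ x + cornerUnit k ∉ 𝒯.Wv) := by
  rcases hside with ⟨hS, hB⟩ | ⟨hS, hB⟩
  · right
    refine ⟨hS, hB, fun hwin => ?_⟩
    rw [σc_mem_U_iff] at hS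
    obtain ⟨hxO, e, he, hxe⟩ := hS
    have hall : ∀ v ∈ dartEdge x k, v ∈ 𝒯.Wv := by
      intro v hv
      rcases mem_dartEdge_iff.1 hv with rfl | rfl
      · exact 𝒯.acc_window e he _ hxe
      · exact hwin
    rcases 𝒯.closure e he x hxe hxO _ (dartEdge_mem_edgeSet x k) (mem_dartEdge_iff.2 (Or.inl rfl)) hall with h | h | h
    · exact hxO (𝒯.hub_O _ h x (mem_dartEdge_iff.2 (Or.inl rfl)))
    · exact hcons _ h hopen
    · exact hB ((βc_mem_U_iff 𝒯).2 h)
  · left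
    refine ⟨hS, ?_, hB⟩
    rw [βc_mem_U_iff] at hB
    by_contra hxO
    exact hS ((σc_mem_U_iff 𝒯).2 ⟨hxO, _, hB, mem_dartEdge_iff.2 (Or.inl rfl)⟩)

end TileData

/-! ### Contact points on arcs -/

/-- A contact point is not a lattice point of the cell grid. [folklore] -/
theorem cpt_ne_toComplex (x : Site 2) (k : Fin 4) (w : Site 2) : cpt x k ≠ Site.toComplex w := by
  intro h
  obtain ⟨hre, him⟩ := seg2Pt_σc_re_im x k (1 / 4)
  rw [cpt] at h
  rw [h, Site.toComplex_re] at hre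
  rw [h, Site.toComplex_im] at him
  fin_cases k <;> rw [toComplex_cornerUnit_table] at hre him <;>
    simp only [Complex.one_re, Complex.one_im, Complex.I_re, Complex.I_im, Complex.neg_re, Complex.neg_im,
      neg_zero, mul_zero, mul_one, mul_neg, add_zero] at hre him
  · have : (2 : ℝ) * (w 1 - 2 * x 1) = 1 := by linarith
    have h' : (2 : ℤ) * (w 1 - 2 * x 1) = 1 := by exact_mod_cast this
    omega
  · have : (2 : ℝ) * (w 0 - 2 * x 0) = 1 := by linarith
    have h' : (2 : ℤ) * (w 0 - 2 * x 0) = 1 := by exact_mod_cast this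
    omega
  · have : (2 : ℝ) * (w 1 - 2 * x 1) = 1 := by linarith
    have h' : (2 : ℤ) * (w 1 - 2 * x 1) = 1 := by exact_mod_cast this
    omega
  · have : (2 : ℝ) * (w 0 - 2 * x 0) = 1 := by linarith
    have h' : (2 : ℤ) * (w 0 - 2 * x 0) = 1 := by exact_mod_cast this
    omega

section Arcs

variable {U : Finset (Site 2)} {d₀ : Site 2 × Fin 4} (h₀ : IsBd U d₀) (hP : PinchFree U)

/-- **A contact point lies on an arc iff it lies on a loop side indexed in the arc's range.** [folklore] -/
theorem cpt_mem_arc_iff (a : Fin 4 → ℕ) (ha0 : a 0 = 0) (hmono : StrictMono a) (ha3 : a 3 < period h₀)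
    (m : Fin 4) (x : Site 2) (k : Fin 4) :
    cpt x k ∈ (cellRect h₀ hP a hmono ha3).arc m ↔
      ∃ j ∈ Ico (a m) (if h : (m : ℕ) + 1 < 4 then a ⟨m + 1, h⟩ else period h₀),
        cpt x k ∈ edgeSeg (vert U d₀ j) (dirAt U d₀ j) := by
  rw [arc_cellRect h₀ hP a ha0 hmono ha3 m, mem_union, mem_iUnion₂, mem_singleton_iff]
  constructor
  · rintro (⟨j, hj, h⟩ | h)
    · exact ⟨j, hj, h⟩
    · exact absurd h (cpt_ne_toComplex x k _)
  · rintro ⟨j, hj, h⟩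
    exact Or.inl ⟨j, hj, h⟩

/-- `cpt_mem_arc_iff` for the arc `3` (sides `[a₃, P)`). [folklore] -/
theorem cpt_mem_arc_three_iff (a : Fin 4 → ℕ) (ha0 : a 0 = 0) (hmono : StrictMono a) (ha3 : a 3 < period h₀)
    (x : Site 2) (k : Fin 4) :
    cpt x k ∈ (cellRect h₀ hP a hmono ha3).arc 3 ↔
      ∃ l, a 3 ≤ l ∧ l < period h₀ ∧ cpt x k ∈ edgeSeg (vert U d₀ l) (dirAt U d₀ l) := by
  rw [cpt_mem_arc_iff h₀ hP a ha0 hmono ha3 3 x k, dif_neg (show ¬ (((3 : Fin 4) : ℕ) + 1 < 4) by decide)]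
  simp only [mem_Ico]
  exact ⟨fun ⟨l, ⟨h1, h2⟩, h⟩ => ⟨l, h1, h2, h⟩, fun ⟨l, h1, h2, h⟩ => ⟨l, ⟨h1, h2⟩, h⟩⟩

/-- `cpt_mem_arc_iff` for the arc `1` (sides `[a₁, a₂)`). [folklore] -/
theorem cpt_mem_arc_one_iff (a : Fin 4 → ℕ) (ha0 : a 0 = 0) (hmono : StrictMono a) (ha3 : a 3 < period h₀)
    (x : Site 2) (k : Fin 4) :
    cpt x k ∈ (cellRect h₀ hP a hmono ha3).arc 1 ↔
      ∃ l, a 1 ≤ l ∧ l < a 2 ∧ cpt x k ∈ edgeSeg (vert U d₀ l) (dirAt U d₀ l) := by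
  rw [cpt_mem_arc_iff h₀ hP a ha0 hmono ha3 1 x k, dif_pos (show (((1 : Fin 4) : ℕ) + 1 < 4) by decide)]
  simp only [mem_Ico]
  exact ⟨fun ⟨l, ⟨h1, h2⟩, h⟩ => ⟨l, h1, h2, h⟩, fun ⟨l, h1, h2, h⟩ => ⟨l, ⟨h1, h2⟩, h⟩⟩

end Arcs

/-! ### Hub cells, attached hub vertices and hub connectivity -/

namespace TileData

variable (𝒯 : TileData)

/-- **Hub cells**: site cells of hub vertices and bond cells of examined open edges. [folklore] -/
def IsHubCell (c : Site 2) : Prop := (∃ v ∈ 𝒯.O, c = σc v) ∨ ∃ (y : Site 2) (m : Fin 4), dartEdge y m ∈ 𝒯.hubE ∧ c = βc y m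

/-- The hub vertices **attached** to a cell: its site (for a site cell) or the endpoints of its
edge (for a bond cell), when they are hub vertices. [folklore] -/
def att (c : Site 2) : Set (Site 2) := {v | v ∈ 𝒯.O ∧ (c = σc v ∨ ∃ m : Fin 4, c = βc v m)}

/-- **Hub connectivity**: joined by examined open edges (same hub). [folklore] -/
def HubConn (v w : Site 2) : Prop := ReflTransGen (fun a b => s(a, b) ∈ 𝒯.hubE) v w

variable {𝒯} in
/-- Hub connectivity is symmetric. [folklore] -/
theorem HubConn.symm {v w : Site 2} (h : 𝒯.HubConn v w) : 𝒯.HubConn w v := by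
  unfold HubConn at h ⊢
  induction h with
  | refl => exact ReflTransGen.refl
  | tail _ hst ih => exact ReflTransGen.head (by rw [Sym2.eq_swap]; exact hst) ih

variable {𝒯} in
/-- Hub connectivity is transitive. [folklore] -/
theorem HubConn.trans {u v w : Site 2} (h1 : 𝒯.HubConn u v) (h2 : 𝒯.HubConn v w) : 𝒯.HubConn u w :=
  ReflTransGen.trans h1 h2

/-- A hub site cell is the cell of a hub vertex. [folklore] -/
theorem mem_O_of_isHubCell_σc {v : Site 2} (h : 𝒯.IsHubCell (σc v)) : v ∈ 𝒯.O := by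
  rcases h with ⟨v', hv', hvv'⟩ | ⟨y, m, -, hym⟩
  · rw [σc_injective hvv']; exact hv'
  · exact absurd hym (σc_ne_βc v y m)

/-- A hub bond cell is the cell of an examined open edge. [folklore] -/
theorem mem_hubE_of_isHubCell_βc {y : Site 2} {m : Fin 4} (h : 𝒯.IsHubCell (βc y m)) : dartEdge y m ∈ 𝒯.hubE := by
  rcases h with ⟨v', -, hvv'⟩ | ⟨y', m', hh, hym⟩
  · exact absurd hvv'.symm (σc_ne_βc v' y m)
  · have : dartEdge y m = dartEdge y' m' :=
      bcell_injOn (dartEdge_mem_edgeSet y m) (dartEdge_mem_edgeSet y' m') (by rw [bcell_dartEdge, bcell_dartEdge, hym])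
    rw [this]; exact hh

/-- Face cells are not hub cells. [folklore] -/
theorem not_isHubCell_φc (f : Site 2) : ¬ 𝒯.IsHubCell (φc f) := by
  rintro (⟨v, -, h⟩ | ⟨y, m, -, h⟩)
  · exact σc_ne_φc v f h.symm
  · exact βc_ne_φc y f m h.symm

/-- The vertices attached to a hub cell at the corner `2y + cornerOff j` are hub-connected to `y`,
and `y` is a hub vertex. [folklore] -/
theorem hubConn_att_corner {y : Site 2} {j : Fin 4} {c : Site 2} (hc : 𝒯.IsHubCell c)
    (hcorner : ∃ i : Fin 4, c = faceAt (σc y + cornerOff j) i) {v : Site 2} (hv : v ∈ 𝒯.att c) :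
    y ∈ 𝒯.O ∧ 𝒯.HubConn v y := by
  obtain ⟨i, rfl⟩ := hcorner
  obtain ⟨i', rfl⟩ := fin4_exists_add j i
  obtain ⟨hvO, hvc⟩ := hv
  -- the four cells around the corner
  have key : ∀ c', 𝒯.IsHubCell c' → (c' = σc y ∨ c' = βc y (j + 2) ∨ c' = φc (faceAt y (j + 2)) ∨ c' = βc y (j + 3)) →
      ∀ w ∈ 𝒯.att c', y ∈ 𝒯.O ∧ 𝒯.HubConn w y := by
    rintro c' hc' (rfl | rfl | rfl | rfl) w ⟨hwO, hwc⟩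
    · -- the site cell: `w = y`
      rcases hwc with h | ⟨m, h⟩
      · rw [σc_injective h]; exact ⟨σc_injective h ▸ hwO, ReflTransGen.refl⟩
      · exact absurd h (σc_ne_βc y w m)
    · -- the bond cell in direction `j + 2`
      have hh := 𝒯.mem_hubE_of_isHubCell_βc hc'
      have hyO : y ∈ 𝒯.O := 𝒯.hub_O _ hh y (mem_dartEdge_iff.2 (Or.inl rfl))
      rcases hwc with h | ⟨m, h⟩
      · exact absurd h.symm (σc_ne_βc w y (j + 2))
      · have he : dartEdge w m = dartEdge y (j + 2) :=
          bcell_injOn (dartEdge_mem_edgeSet w m) (dartEdge_mem_edgeSet y (j + 2)) (by rw [bcell_dartEdge, bcell_dartEdge, h])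
        have hw : w ∈ dartEdge y (j + 2) := he ▸ mem_dartEdge_iff.2 (Or.inl rfl)
        refine ⟨hyO, ?_⟩
        rcases mem_dartEdge_iff.1 hw with rfl | rfl
        · exact ReflTransGen.refl
        · exact ReflTransGen.single (by rw [Sym2.eq_swap]; exact hh)
    · exact absurd hc' (𝒯.not_isHubCell_φc _)
    · have hh := 𝒯.mem_hubE_of_isHubCell_βc hc'
      have hyO : y ∈ 𝒯.O := 𝒯.hub_O _ hh y (mem_dartEdge_iff.2 (Or.inl rfl))
      rcases hwc with h | ⟨m, h⟩
      · exact absurd h.symm (σc_ne_βc w y (j + 3))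
      · have he : dartEdge w m = dartEdge y (j + 3) :=
          bcell_injOn (dartEdge_mem_edgeSet w m) (dartEdge_mem_edgeSet y (j + 3)) (by rw [bcell_dartEdge, bcell_dartEdge, h])
        have hw : w ∈ dartEdge y (j + 3) := he ▸ mem_dartEdge_iff.2 (Or.inl rfl)
        refine ⟨hyO, ?_⟩
        rcases mem_dartEdge_iff.1 hw with rfl | rfl
        · exact ReflTransGen.refl
        · exact ReflTransGen.single (by rw [Sym2.eq_swap]; exact hh)
  refine key _ hc ?_ v ⟨hvO, hvc⟩
  fin_cases i'
  · left; simpa using faceAt_corner_self y j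
  · right; left; exact faceAt_corner_add_one y j
  · right; right; left; exact faceAt_corner_add_two y j
  · right; right; right; exact faceAt_corner_add_three y j

/-- **Two hub cells at a common corner belong to the same hub**: all attached vertices are
hub-connected. [cite: SchrammSmirnov2011, proof of Thm 1.5 (C) (beach uniqueness)] -/
theorem hubConn_of_common_corner {q c₁ c₂ : Site 2} (h₁ : 𝒯.IsHubCell c₁) (h₂ : 𝒯.IsHubCell c₂)
    (hq₁ : ∃ i, c₁ = faceAt q i) (hq₂ : ∃ i, c₂ = faceAt q i) {v₁ v₂ : Site 2} (hv₁ : v₁ ∈ 𝒯.att c₁)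
    (hv₂ : v₂ ∈ 𝒯.att c₂) : 𝒯.HubConn v₁ v₂ := by
  obtain ⟨y, j, rfl⟩ := exists_corner_eq q
  exact (𝒯.hubConn_att_corner h₁ hq₁ hv₁).2.trans (𝒯.hubConn_att_corner h₂ hq₂ hv₂).2.symm

/-! ### Hub contacts along the traced loop -/

section Loop

variable (d₀ : Site 2 × Fin 4)

/-- The out-cell of the `i`-th loop side. [folklore] -/
def outCell (i : ℕ) : Site 2 := faceAt (vert 𝒯.U d₀ i) (dirAt 𝒯.U d₀ i + 3)

/-- The `i`-th loop side is a **hub contact**. [folklore] -/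
def hubContact (i : ℕ) : Prop := 𝒯.IsHubCell (𝒯.outCell d₀ i)

/-- Consecutive out-cells share the corner `vert (i + 1)`. [folklore] -/
theorem outCell_corner (i : ℕ) :
    (∃ m, 𝒯.outCell d₀ i = faceAt (vert 𝒯.U d₀ (i + 1)) m) ∧ ∃ m, 𝒯.outCell d₀ (i + 1) = faceAt (vert 𝒯.U d₀ (i + 1)) m := by
  refine ⟨⟨dirAt 𝒯.U d₀ i + 2, ?_⟩, ⟨_, rfl⟩⟩
  rw [outCell, vert_succ, faceAt_add_unit_add_two]

variable {d₀}

/-- **Consecutive hub contacts belong to the same hub.** [folklore] -/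
theorem hubConn_of_consecutive {i : ℕ} (hi : 𝒯.hubContact d₀ i) (hi' : 𝒯.hubContact d₀ (i + 1)) {v₁ v₂ : Site 2}
    (hv₁ : v₁ ∈ 𝒯.att (𝒯.outCell d₀ i)) (hv₂ : v₂ ∈ 𝒯.att (𝒯.outCell d₀ (i + 1))) : 𝒯.HubConn v₁ v₂ := by
  obtain ⟨hq₁, hq₂⟩ := 𝒯.outCell_corner d₀ i
  exact 𝒯.hubConn_of_common_corner hi hi' hq₁ hq₂ hv₁ hv₂

/-- Hub cells have attached vertices. [folklore] -/
theorem att_nonempty {c : Site 2} (hc : 𝒯.IsHubCell c) : (𝒯.att c).Nonempty := by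
  rcases hc with ⟨v, hv, rfl⟩ | ⟨y, m, hh, rfl⟩
  · exact ⟨v, hv, Or.inl rfl⟩
  · exact ⟨y, 𝒯.hub_O _ hh y (mem_dartEdge_iff.2 (Or.inl rfl)), Or.inr ⟨m, rfl⟩⟩

/-- **A run of hub contacts belongs to one hub**: along consecutive hub contacts `i, …, j` all
attached vertices are hub-connected. [cite: SchrammSmirnov2011, proof of Thm 1.5 (C) (one beach per bay)] -/
theorem hubConn_of_run {i j : ℕ} (hij : i ≤ j) (hrun : ∀ l, i ≤ l → l ≤ j → 𝒯.hubContact d₀ l) {v₁ v₂ : Site 2}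
    (hv₁ : v₁ ∈ 𝒯.att (𝒯.outCell d₀ i)) (hv₂ : v₂ ∈ 𝒯.att (𝒯.outCell d₀ j)) : 𝒯.HubConn v₁ v₂ := by
  induction j, hij using Nat.le_induction generalizing v₂ with
  | base =>
    exact 𝒯.hubConn_of_common_corner (hrun i le_rfl le_rfl) (hrun i le_rfl le_rfl) ⟨_, rfl⟩ ⟨_, rfl⟩ hv₁ hv₂
  | succ j hij ih =>
    obtain ⟨w, hw⟩ := 𝒯.att_nonempty (hrun j hij (Nat.le_succ j))
    exact (ih (fun l h1 h2 => hrun l h1 (h2.trans (Nat.le_succ j))) hw).trans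
      (𝒯.hubConn_of_consecutive (hrun j hij (Nat.le_succ j)) (hrun (j + 1) (hij.trans (Nat.le_succ j)) le_rfl) hw hv₂)

/-- **Hub dockings are contacts with hub site cells.**  If an open contact dart `(x, k)` with
`σ x ∉ U`, `β x k ∈ U` has its contact point on the `i`-th side of a traced boundary loop, then
`outCell i = σ x`, the side is a hub contact and `x` is attached to it. [folklore] -/
theorem hubContact_of_docking (h₀ : IsBd 𝒯.U d₀) {x : Site 2} {k : Fin 4} (hxO : x ∈ 𝒯.O) (hB : βc x k ∈ 𝒯.U)
    {i : ℕ} (hmem : cpt x k ∈ edgeSeg (vert 𝒯.U d₀ i) (dirAt 𝒯.U d₀ i)) :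
    𝒯.outCell d₀ i = σc x ∧ 𝒯.hubContact d₀ i ∧ x ∈ 𝒯.att (𝒯.outCell d₀ i) := by
  have h := (outCell_eq_of_cpt_mem_edgeSeg (isBd_bdOrbit h₀ i) hmem).2 hB
  have hout : 𝒯.outCell d₀ i = σc x := h.2
  refine ⟨hout, ?_, ?_⟩
  · rw [hubContact, hout]; exact Or.inl ⟨x, hxO, rfl⟩
  · rw [hout]; exact ⟨hxO, Or.inl rfl⟩

end Loop

/-! ### The crossing event of a link quad between two hub runs -/

section PortQuad

variable {d₀ : Site 2 × Fin 4}

/-- **With the window sealed, every open boundary contact is a hub docking.**  If `η` closes the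
examined closed edges and every edge leaving the window from a site of the domain, then an
`η`-open contact dart `(x, k)` satisfying the boundary dichotomy has `σ x ∉ U`, `x ∈ 𝒪`,
`β x k ∈ U`. [cite: SchrammSmirnov2011, proof of Thm 1.5 (C)] -/
theorem docking_of_sealed {η : BondConfig (Site 2)} (hcons : ∀ e ∈ 𝒯.clE, e ∉ η)
    (hext : ∀ (x : Site 2) (k : Fin 4), σc x ∈ 𝒯.U → x + cornerUnit k ∉ 𝒯.Wv → dartEdge x k ∉ η)
    {x : Site 2} {k : Fin 4} (hopen : dartEdge x k ∈ η)
    (hside : (σc x ∈ 𝒯.U ∧ βc x k ∉ 𝒯.U) ∨ (σc x ∉ 𝒯.U ∧ βc x k ∈ 𝒯.U)) :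
    σc x ∉ 𝒯.U ∧ x ∈ 𝒯.O ∧ βc x k ∈ 𝒯.U := by
  rcases 𝒯.touchable hcons hopen hside with h | ⟨hS, -, hW⟩
  · exact h
  · exact absurd hopen (hext x k hS hW)

/-- **The crossing event of a link quad is the docking-walk event.**  Mark the traced loop of the
tile domain at `0 = a₀ < a₁ < a₂ < a₃ < P`; quad side `0` is the union of the loop sides `[a₃, P)`,
quad side `2` that of `[a₁, a₂)`.  Then, for a configuration `η` closing the examined closed edges
and the edges leaving the window (the sealed window), the link quad is crossed by the `η`-open
drawing iff there are hub dockings `(x, k)` on a side of `[a₃, P)` and `(x', k')` on a side of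
`[a₁, a₂)` — `σ ∉ U`, `β ∈ U`, `η`-open edges — whose far endpoints are joined by a chain of
`η`-open steps through sites of the domain. [cite: SchrammSmirnov2011, proof of Thm 1.5 (C) ("v, v′ ∈ Z_o are connected by an edge in G* if the two corresponding beaches … are connected by an open crossing in ω̃|([Q₀]∖M)")] -/
theorem mem_z2QuadConfig_linkQuad_iff_docking {δ : ℝ} (hδ : 0 < δ) (h₀ : IsBd 𝒯.U d₀) (a : Fin 4 → ℕ) (ha0 : a 0 = 0)
    (hmono : StrictMono a) (ha3 : a 3 < period h₀) {D : Set ℂ} (hD : cellScale δ hδ '' Kset 𝒯.U ⊆ D)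
    {η : BondConfig (Site 2)} (hcons : ∀ e ∈ 𝒯.clE, e ∉ η)
    (hext : ∀ (x : Site 2) (k : Fin 4), σc x ∈ 𝒯.U → x + cornerUnit k ∉ 𝒯.Wv → dartEdge x k ∉ η) :
    linkQuad hδ h₀ 𝒯.pinchFree 𝒯.edgeConn 𝒯.coHoleFree a hmono ha3 hD ∈ z2QuadConfig D δ η ↔
      ∃ (x : Site 2) (k : Fin 4) (x' : Site 2) (k' : Fin 4),
        dartEdge x k ∈ η ∧ dartEdge x' k' ∈ η ∧ σc x ∉ 𝒯.U ∧ βc x k ∈ 𝒯.U ∧ σc x' ∉ 𝒯.U ∧ βc x' k' ∈ 𝒯.U ∧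
        (∃ l, a 3 ≤ l ∧ l < period h₀ ∧ cpt x k ∈ edgeSeg (vert 𝒯.U d₀ l) (dirAt 𝒯.U d₀ l)) ∧
        (∃ l, a 1 ≤ l ∧ l < a 2 ∧ cpt x' k' ∈ edgeSeg (vert 𝒯.U d₀ l) (dirAt 𝒯.U d₀ l)) ∧
        ReflTransGen (OpenStep 𝒯.U η) (x + cornerUnit k) (x' + cornerUnit k') := by
  classical
  have hslit : ∀ x k, σc x ∈ 𝒯.U → σc (x + cornerUnit k) ∈ 𝒯.U → βc x k ∈ 𝒯.U :=
    fun x k => 𝒯.βc_mem_of_σc_mem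
  have hinner : ∀ x k, σc x ∉ 𝒯.U → βc x k ∈ 𝒯.U → σc (x + cornerUnit k) ∈ 𝒯.U :=
    fun x k => 𝒯.σc_far_mem_of_βc_mem
  have harc3 := cpt_mem_arc_three_iff h₀ 𝒯.pinchFree a ha0 hmono ha3
  have harc1 := cpt_mem_arc_one_iff h₀ 𝒯.pinchFree a ha0 hmono ha3
  rw [mem_z2QuadConfig_linkQuad_iff hδ h₀ 𝒯.pinchFree 𝒯.edgeConn 𝒯.coHoleFree a hmono ha3 hD hslit hinner η]
  constructor
  · rintro ⟨x, k, x', k', hk, hk', h3, h1, hs, hs', hchain⟩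
    obtain ⟨l, hl1, hl2, hl⟩ := (harc3 x k).1 h3
    obtain ⟨l', hl'1, hl'2, hl'⟩ := (harc1 x' k').1 h1
    obtain ⟨hS, -, hB⟩ := 𝒯.docking_of_sealed hcons hext hk hs
    obtain ⟨hS', -, hB'⟩ := 𝒯.docking_of_sealed hcons hext hk' hs'
    refine ⟨x, k, x', k', hk, hk', hS, hB, hS', hB', ⟨l, hl1, hl2, hl⟩, ⟨l', hl'1, hl'2, hl'⟩, ?_⟩
    simpa only [innerSite, if_neg hS, if_neg hS'] using hchain
  · rintro ⟨x, k, x', k', hk, hk', hS, hB, hS', hB', h3, h1, hchain⟩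
    refine ⟨x, k, x', k', hk, hk', (harc3 x k).2 h3, (harc1 x' k').2 h1, Or.inr ⟨hS, hB⟩, Or.inr ⟨hS', hB'⟩, ?_⟩
    simpa only [innerSite, if_neg hS, if_neg hS'] using hchain

/-- **Docking vertices belong to the run's hub.**  In the situation of
`mem_z2QuadConfig_linkQuad_iff_docking`, a docking `(x, k)` on a side `l` of a hub run is attached
to that side (`outCell l = σ x`), so `x` is hub-connected to every vertex attached to any side of
the run (`hubConn_of_run`). [cite: SchrammSmirnov2011, proof of Thm 1.5 (C)] -/
theorem hubConn_of_docking_of_hubRun (h₀ : IsBd 𝒯.U d₀) {i j : ℕ} (hrun : ∀ l, i ≤ l → l < j → 𝒯.hubContact d₀ l)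
    {x : Site 2} {k : Fin 4} (hS : σc x ∉ 𝒯.U) (hB : βc x k ∈ 𝒯.U) {l : ℕ} (hl : i ≤ l ∧ l < j)
    (hmem : cpt x k ∈ edgeSeg (vert 𝒯.U d₀ l) (dirAt 𝒯.U d₀ l)) {l' : ℕ} (hl' : i ≤ l' ∧ l' < j)
    {v : Site 2} (hv : v ∈ 𝒯.att (𝒯.outCell d₀ l')) : 𝒯.HubConn x v := by
  have hxO : x ∈ 𝒯.O := by
    by_contra hxO
    exact hS ((σc_mem_U_iff 𝒯).2 ⟨hxO, _, (βc_mem_U_iff 𝒯).1 hB, mem_dartEdge_iff.2 (Or.inl rfl)⟩)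
  obtain ⟨-, -, hatt⟩ := 𝒯.hubContact_of_docking h₀ hxO hB hmem
  rcases le_total l l' with hll' | hll'
  · exact 𝒯.hubConn_of_run hll' (fun m h1 h2 => hrun m (hl.1.trans h1) (lt_of_le_of_lt h2 hl'.2)) hatt hv
  · exact (𝒯.hubConn_of_run hll' (fun m h1 h2 => hrun m (hl'.1.trans h1) (lt_of_le_of_lt h2 hl.2)) hv hatt).symm

end PortQuad

end TileData

end CellComplex

end Literature.Probability.Percolation

end
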